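import Literature.Probability.Percolation.MarkedLoopTemperleyLieb
import Literature.Probability.LatticeModels.TemperleyLiebGeneralLoopWeight
import Mathlib.LinearAlgebra.Dimension.Constructions
import HarnessLib

/-!
# The planar (link-pattern) Temperley–Lieb module at every loop weight `δ`

Topic `Literature/Probability/LatticeModels`; a rider on `TemperleyLiebLinkPatterns.lean` (Pearce–Rittenberg–de Gier–Nienhuis 2002: `PerfectMatching`, the move
`connect`, `LinkPattern L` = the NON-CROSSING pairings — "the link patterns … spanning the left ideal `T I₀`", the `0`-defect sector —, the generators
`tlGen δ a b` / `tlE δ j` on ALL pairings; its docstring lists «invariance of the span of `LinkPattern` under `tlE` (planarity is preserved)» as NOT done), on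
`Literature/Probability/Percolation/MarkedLoopTemperleyLieb.lean` (★★★ `isNonCrossing_connect_succ`: every nearest-neighbour move preserves link patterns) and on
`TemperleyLiebGeneralLoopWeight.lean` (★★★ `isTemperleyLiebFamily_tlE`: `tlE δ` is a Temperley–Lieb family with loop weight `δ` on all pairings, for every `δ`).
THIS FILE BUILDS THE SUB-REPRESENTATION ON LINK PATTERNS AS ITS OWN MODULE, AT EVERY LOOP WEIGHT:

* `LinkPattern.connectSucc P j` — the move at the sites `j, j+1` ON LINK PATTERNS (a link pattern by `isNonCrossing_connect_succ`);
* `tlL δ j` — the Temperley–Lieb generator on the free module `LinkPattern (n+2) →₀ R` (`δ_P ↦ δ • δ_P` if `P` pairs `j` with `j+1`, else `δ_{P.connectSucc j}`),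
  `tlL_single`; `lpVal` — the embedding `LinkPattern (n+2) →₀ R ↪ PerfectMatching (n+2) →₀ R` (`Finsupp.lmapDomain` of `Subtype.val`), `lpVal_injective`, and ★
  `lpVal_comp_tlL` — **THE EMBEDDING INTERTWINES `tlL δ j` WITH `tlE δ j`**: the span of the link patterns is a sub-representation (the planarity statement of the
  TL file, as an intertwiner);
* ★★★ `isTemperleyLiebFamily_tlL` — **FOR EVERY `δ`, THE GENERATORS `tlL δ j` ON `LinkPattern (n+2) →₀ R` FORM A TEMPERLEY–LIEB FAMILY WITH LOOP WEIGHT `δ`**: the planar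
  (standard, `0`-defect) module of `TL_{n+2}(δ)` as a kernel object — the relations are pulled back from all pairings through the injective intertwiner;
* `finrank_linkModule` — its rank is the number of link patterns, `= catalan (m+1)` on `2m + 2` sites (the marked-loop lineage's `card_ncMatching_two_mul` through
  the bridge `card_linkPattern_eq_card_ncMatching`) — Pearce–Rittenberg–de Gier–Nienhuis's Catalan dimension of the `0`-defect sector;
* ★★ `tlL_braid` / `tlL_braid_comm` / `tlL_kauffmanGen_mul_kauffmanGen` — KAUFFMAN'S BRAID REPRESENTATION OF `B_{n+2}` ON THE PLANAR MODULE at every loop value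
  (`a² + δab + b² = 0`), with its inverse generators; at `δ = 1`, `(a, b) = (−τ, −τ²)` and `n + 2 = k + 1` this is the representation in which the marked-loop
  lineage's rotation of Khristoforov–Smirnov's `k` marks is the periodic element `g_{*,0} ∘ ρ` (`MarkedLoopTemperleyLiebCoords.lean`, dual coordinates).

## References
* P. A. Pearce, V. Rittenberg, J. de Gier, B. Nienhuis, *Temperley–Lieb stochastic processes*, J. Phys. A 35 (2002) L661–L668, §2 ((TL), (monoid), the link
  patterns `C_{L,m}`, "non-intersecting half-loops", the left ideal `T I₀`).
* L. H. Kauffman, *Knots and Physics* (1991), Part I §7 (relations [𝒜]; `ρ(σᵢ) = A + A⁻¹Uᵢ`, `ρ(σᵢ⁻¹) = A⁻¹ + AUᵢ`; Prop. 7.5).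
* R. P. Grimaldi, *Fibonacci and Catalan numbers* (2012), Ex. 32.3 (the Catalan count of non-crossing chord systems) — through the lineage's `MarkedLoopCatalan.lean`.

## Mathlib / tree
Tree: `TemperleyLiebLinkPatterns.lean` (`LinkPattern`, `PerfectMatching.connect`, `connect_of_partner_eq`, `tlE`, `IsTemperleyLiebFamily`), `TemperleyLiebGeneralLoopWeight.lean`
(`tlGen_single_eq`, `isTemperleyLiebFamily_tlE`), `TemperleyLiebBraid.lean` ed. 2 (`kauffmanGen`, `IsTemperleyLiebFamily.braid_of_loopWeight`, `.braid_comm_of_loopWeight`,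
`.kauffmanGen_mul_kauffmanGen`), `Percolation/MarkedLoopTemperleyLieb.lean` (`isNonCrossing_connect_succ`, `card_linkPattern_eq_card_ncMatching`), `Percolation/MarkedLoopCatalan.lean`
(`card_ncMatching_two_mul`). Mathlib: `Finsupp.lift`, `Finsupp.lmapDomain`, `Finsupp.mapDomain_injective`, `Finsupp.lhom_ext`, `Module.finrank_finsupp_self`.
-/

namespace Literature.Probability.LatticeModels.TemperleyLieb

open Function
open Literature.Probability.Percolation.MarkedLoops (isNonCrossing_connect_succ card_linkPattern_eq_card_ncMatching card_ncMatching_two_mul)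

variable {n : ℕ}

/-! ### The move on link patterns -/

/-- **the nearest-neighbour move at the sites `j, j+1` on LINK PATTERNS** of `n + 2` sites (planar by the marked-loop bridge `isNonCrossing_connect_succ`).
[cite: PearceRittenbergDeGierNienhuis2002, §2 (monoid), (the `0`-defect link patterns)] -/
noncomputable def LinkPattern.connectSucc (P : LinkPattern (n + 1 + 1)) (j : Fin (n + 1)) : LinkPattern (n + 1 + 1) :=
  ⟨P.1.connect (Fin.castSucc j) j.succ, isNonCrossing_connect_succ P j⟩

/-- the underlying pairing of the moved link pattern. [cite: PearceRittenbergDeGierNienhuis2002, §2 (monoid)] -/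
theorem LinkPattern.connectSucc_val (P : LinkPattern (n + 1 + 1)) (j : Fin (n + 1)) : (P.connectSucc j).1 = P.1.connect (Fin.castSucc j) j.succ := rfl

/-- if `P` already pairs `j` with `j+1` the move does nothing (a loop closes). [cite: PearceRittenbergDeGierNienhuis2002, §2 (monoid)] -/
theorem LinkPattern.connectSucc_of_partner_eq (P : LinkPattern (n + 1 + 1)) {j : Fin (n + 1)} (h : P.1.partner (Fin.castSucc j) = j.succ) :
    P.connectSucc j = P :=
  Subtype.ext (PerfectMatching.connect_of_partner_eq P.1 h)

/-! ### The generators on the planar module and the intertwiner -/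

section LinkModule

variable (R : Type*) [CommRing R]

/-- **the Temperley–Lieb generator `eⱼ` with loop weight `δ` on the PLANAR module** `LinkPattern (n+2) →₀ R`: `δ_P ↦ δ • δ_P` if `P` pairs `j` with `j+1`, else
`δ_P ↦ δ_{P.connectSucc j}` (Pearce–Rittenberg–de Gier–Nienhuis's action on the `0`-defect link patterns). [cite: PearceRittenbergDeGierNienhuis2002, §2 (TL), (monoid), (`T I₀`)] -/
noncomputable def tlL (δ : R) (j : Fin (n + 1)) : (LinkPattern (n + 1 + 1) →₀ R) →ₗ[R] (LinkPattern (n + 1 + 1) →₀ R) :=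
  Finsupp.lift (LinkPattern (n + 1 + 1) →₀ R) R (LinkPattern (n + 1 + 1)) fun P =>
    if P.1.partner (Fin.castSucc j) = j.succ then δ • Finsupp.single P 1 else Finsupp.single (P.connectSucc j) 1

variable {R}

/-- the planar generator on a basis vector, in one formula: `eⱼ δ_P = δ^{[P j = j+1]} · δ_{P.connectSucc j}`. [cite: PearceRittenbergDeGierNienhuis2002, §2 (TL), (monoid)] -/
theorem tlL_single (δ : R) (j : Fin (n + 1)) (P : LinkPattern (n + 1 + 1)) (c : R) :
    tlL R δ j (Finsupp.single P c) = (if P.1.partner (Fin.castSucc j) = j.succ then δ else 1) • Finsupp.single (P.connectSucc j) c := by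
  simp only [tlL, Finsupp.lift_apply, Finsupp.sum_single_index, zero_smul]
  split_ifs with h
  · rw [P.connectSucc_of_partner_eq h, ← Finsupp.smul_single_one P c, smul_comm]
  · rw [one_smul, Finsupp.smul_single_one]

variable (R)

/-- **the embedding of the planar module into the module of all pairings** (forget planarity). [cite: PearceRittenbergDeGierNienhuis2002, §2 (link patterns ⊂ pairings)] -/
noncomputable def lpVal : (LinkPattern (n + 1 + 1) →₀ R) →ₗ[R] (PerfectMatching (n + 1 + 1) →₀ R) :=
  Finsupp.lmapDomain R R (Subtype.val : LinkPattern (n + 1 + 1) → PerfectMatching (n + 1 + 1))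

/-- the embedding is injective. [cite: PearceRittenbergDeGierNienhuis2002, §2] -/
theorem lpVal_injective : Function.Injective (lpVal R (n := n)) :=
  Finsupp.mapDomain_injective Subtype.val_injective

variable {R}

/-- the embedding on a basis vector. [cite: PearceRittenbergDeGierNienhuis2002, §2] -/
theorem lpVal_single (P : LinkPattern (n + 1 + 1)) (c : R) : lpVal R (Finsupp.single P c) = Finsupp.single P.1 c := by
  rw [lpVal, Finsupp.lmapDomain_apply, Finsupp.mapDomain_single]

variable (R)

/-- ★ **THE EMBEDDING INTERTWINES THE PLANAR GENERATOR WITH THE GENERATOR ON ALL PAIRINGS**: `lpVal ∘ tlL δ j = tlE δ j ∘ lpVal` — the span of the link patterns is a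
sub-representation of `PerfectMatching (n+2) →₀ R` under every `tlE δ j` (the planarity item of the TL file, as an intertwiner). [cite: PearceRittenbergDeGierNienhuis2002, §2 (TL), (monoid), (`T I₀`)] -/
theorem lpVal_comp_tlL (δ : R) (j : Fin (n + 1)) : lpVal R ∘ₗ tlL R δ j = tlE δ j ∘ₗ lpVal R := by
  refine Finsupp.lhom_ext fun P c => ?_
  rw [LinearMap.comp_apply, LinearMap.comp_apply, tlL_single, map_smul, lpVal_single, lpVal_single]
  show _ = tlGen R δ (Fin.castSucc j) j.succ (Finsupp.single P.1 c)
  rw [tlGen_single_eq]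
  rfl

variable {R}

/-- composites of intertwined operators are intertwined. [folklore] -/
private theorem lpVal_comp_mul {V W : Type*} [AddCommGroup V] [Module R V] [AddCommGroup W] [Module R W] (ι : V →ₗ[R] W)
    {f g : Module.End R V} {e e' : Module.End R W} (hf : ι ∘ₗ f = e ∘ₗ ι) (hg : ι ∘ₗ g = e' ∘ₗ ι) : ι ∘ₗ (f * g) = (e * e') ∘ₗ ι := by
  rw [Module.End.mul_eq_comp, Module.End.mul_eq_comp, ← LinearMap.comp_assoc, hf, LinearMap.comp_assoc, hg, ← LinearMap.comp_assoc]

/-- an injective intertwiner reflects equalities. [folklore] -/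
private theorem eq_of_comp_eq {V W : Type*} [AddCommGroup V] [Module R V] [AddCommGroup W] [Module R W] {ι : V →ₗ[R] W} (hι : Function.Injective ι)
    {f g : Module.End R V} (h : ι ∘ₗ f = ι ∘ₗ g) : f = g :=
  LinearMap.ext fun v => hι (by rw [← LinearMap.comp_apply, h, LinearMap.comp_apply])

variable (R)

/-- ★★★ **FOR EVERY `δ`, THE PLANAR MODULE `LinkPattern (n+2) →₀ R` IS A TEMPERLEY–LIEB REPRESENTATION WITH LOOP WEIGHT `δ`** under the generators `tlL δ j` — all of (TL):
`eⱼ² = δeⱼ`, `eⱼ e_{j±1} eⱼ = eⱼ`, far commutation — pulled back from `isTemperleyLiebFamily_tlE` through the injective intertwiner `lpVal` (Pearce–Rittenberg–de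
Gier–Nienhuis's `0`-defect sector as its own module). [cite: PearceRittenbergDeGierNienhuis2002, §2 (TL), (the link patterns spanning `T I₀`)] -/
theorem isTemperleyLiebFamily_tlL (δ : R) (n : ℕ) : IsTemperleyLiebFamily δ (fun j : Fin (n + 1) => tlL (n := n) R δ j) := by
  have H := isTemperleyLiebFamily_tlE R δ (n + 1)
  have hι := lpVal_injective R (n := n)
  have h1 := fun j : Fin (n + 1) => lpVal_comp_tlL R δ j (n := n)
  refine ⟨fun j => ?_, fun j k hjk => ?_, fun j k hjk => ?_, fun i j hij => ?_⟩
  · apply eq_of_comp_eq hι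
    rw [lpVal_comp_mul _ (h1 j) (h1 j), H.sq j, LinearMap.smul_comp, LinearMap.comp_smul, h1 j]
  · apply eq_of_comp_eq hι
    rw [lpVal_comp_mul _ (lpVal_comp_mul _ (h1 j) (h1 k)) (h1 j), H.cubic_succ j k hjk, h1 j]
  · apply eq_of_comp_eq hι
    rw [lpVal_comp_mul _ (lpVal_comp_mul _ (h1 k) (h1 j)) (h1 k), H.cubic_pred j k hjk, h1 k]
  · apply eq_of_comp_eq hι
    rw [lpVal_comp_mul _ (h1 i) (h1 j), lpVal_comp_mul _ (h1 j) (h1 i), H.comm i j hij]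

/-- **the rank of the planar module is the number of link patterns** — `catalan (m+1)` on `2m + 2` sites (Pearce–Rittenberg–de Gier–Nienhuis's Catalan dimension of
the `0`-defect sector, via the marked-loop lineage's count of non-crossing matchings). [cite: PearceRittenbergDeGierNienhuis2002, §2 (`C_{L,m}`); Grimaldi2012, Ex. 32.3] -/
theorem finrank_linkModule [Nontrivial R] (m : ℕ) : Module.finrank R (LinkPattern (2 * m + 1 + 1) →₀ R) = catalan (m + 1) := by
  rw [Module.finrank_finsupp_self, card_linkPattern_eq_card_ncMatching, show 2 * m + 1 + 1 = 2 * (m + 1) by ring, card_ncMatching_two_mul]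

/-- ★★ **KAUFFMAN'S BRAID REPRESENTATION OF `B_{n+2}` ON THE PLANAR MODULE, AT EVERY LOOP VALUE**: for `a² + δab + b² = 0` the operators `a·1 + b·tlL δ j` satisfy
the braid relations. [cite: Kauffman1991KnotsPhysics, Part I §7: ρ(σᵢ) = A + A⁻¹Uᵢ, Prop. 7.5; PearceRittenbergDeGierNienhuis2002, §2 (TL)] -/
theorem tlL_braid (δ : R) (n : ℕ) {a b : R} (hab : a ^ 2 + δ * a * b + b ^ 2 = 0) (j k : Fin (n + 1)) (hjk : k.val = j.val + 1) :
    kauffmanGen (fun j : Fin (n + 1) => tlL (n := n) R δ j) a b j * kauffmanGen (fun j : Fin (n + 1) => tlL (n := n) R δ j) a b k *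
        kauffmanGen (fun j : Fin (n + 1) => tlL (n := n) R δ j) a b j =
      kauffmanGen (fun j : Fin (n + 1) => tlL (n := n) R δ j) a b k * kauffmanGen (fun j : Fin (n + 1) => tlL (n := n) R δ j) a b j *
        kauffmanGen (fun j : Fin (n + 1) => tlL (n := n) R δ j) a b k :=
  (isTemperleyLiebFamily_tlL R δ n).braid_of_loopWeight hab j k hjk

/-- far Kauffman generators commute on the planar module. [cite: Kauffman1991KnotsPhysics, Part I §7 Prop. 7.5, proof step «Third»; PearceRittenbergDeGierNienhuis2002, §2 (TL)] -/
theorem tlL_braid_comm (δ : R) (n : ℕ) (a b : R) (i j : Fin (n + 1)) (hij : j.val + 1 < i.val) :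
    kauffmanGen (fun j : Fin (n + 1) => tlL (n := n) R δ j) a b i * kauffmanGen (fun j : Fin (n + 1) => tlL (n := n) R δ j) a b j =
      kauffmanGen (fun j : Fin (n + 1) => tlL (n := n) R δ j) a b j * kauffmanGen (fun j : Fin (n + 1) => tlL (n := n) R δ j) a b i :=
  (isTemperleyLiebFamily_tlL R δ n).braid_comm_of_loopWeight a b i j hij

/-- the inverse Kauffman generators on the planar module (`aa' = 1`, `ab' + ba' + δbb' = 0`; `σⱼ⁻¹ = A⁻¹ + AUⱼ`). [cite: Kauffman1991KnotsPhysics, Part I §7: ρ(σᵢ⁻¹) = A⁻¹ + AUᵢ, Prop. 7.5, proof step «First»] -/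
theorem tlL_kauffmanGen_mul_kauffmanGen (δ : R) (n : ℕ) {a b a' b' : R} (h1 : a * a' = 1) (h2 : a * b' + b * a' + δ * b * b' = 0) (j : Fin (n + 1)) :
    kauffmanGen (fun j : Fin (n + 1) => tlL (n := n) R δ j) a b j * kauffmanGen (fun j : Fin (n + 1) => tlL (n := n) R δ j) a' b' j = 1 :=
  (isTemperleyLiebFamily_tlL R δ n).kauffmanGen_mul_kauffmanGen h1 h2 j

end LinkModule

end Literature.Probability.LatticeModels.TemperleyLieb
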